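import Literature.Geometry.Riemannian.GurskyViaclovskyClosednessProofs
import Mathlib.Analysis.SpecialFunctions.Sqrt
import HarnessLib

/-!
# Gursky–Viaclovsky closedness: the concavity of `σ₂^{1/2}` in the form the Evans–Krylov proof uses

Support file (everything PROVED; no definition, no named fact) for the named fact
`Literature.Geometry.Riemannian.gurskyViaclovsky_pathClosed_weighted_four`.

Gilbarg–Trudinger's proof of the interior `C^{2,α}` estimate (Thm. 17.14, general case, p. 461 of
the 2001 printing) uses hypothesis (ii)' ("`F` concave in `r` on the range of `D²u`") in exactly
two ways: infinitesimally at range points (for (17.45)), and through the supporting-hyperplane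
inequality
`F_{ij}(y,u(y),Du(y),D²u(y))(D_{ij}u(y) − D_{ij}u(x)) ≤ F(y,…,D²u(x)) − F(y,…,D²u(y))`
between the admissible point `D²u(y)` and the hybrid point `D²u(x)` (lower-order data frozen at
`y`). For Gursky–Viaclovsky's operator `F = σ₂^{1/2}` (concave on the cone `Γ₂⁺`, their
Prop. 1 (iii)) this file supplies, at the level of symmetric `4 × 4` frame arrays:

* `hasDerivAt_sigma2_segment`, `hasDerivAt_sqrt_sigma2_segment` — the derivative of
  `s ↦ σ₂^{1/2}(A + s(B − A))` at `0` is `(σ₂(A,B) − σ₂(A))/σ₂(A)^{1/2}`;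
* `sqrt_sigma2_le_tangent` — **the supporting-hyperplane inequality**
  `σ₂^{1/2}(B) − σ₂^{1/2}(A) ≤ (σ₂(A,B) − σ₂(A))/σ₂(A)^{1/2}` for `A, B ∈ Γ₂⁺` — a one-line
  consequence of Gårding's inequality `σ₂(A)^{1/2}σ₂(B)^{1/2} ≤ σ₂(A,B)`
  (`sqrt_mul_sqrt_le_sigma2Polar`);
* `le_sqrt_sigma2_convex_comb`, `gammaTwoPos_sigma2_superlevel_convex` — the admissible superlevel
  sets `{A ∈ Γ₂⁺ : σ₂^{1/2}(A) ≥ κ}` are convex (so segments between admissible arrays with margin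
  stay admissible with the same margin).

## References

* M. J. Gursky, J. A. Viaclovsky, J. Differential Geom. 63 (2003) 131–154, §2 Prop. 1 (iii),
  §5. [GurskyViaclovsky2003]
* D. Gilbarg, N. S. Trudinger, *Elliptic Partial Differential Equations of Second Order* (2001),
  §17.4, proof of Thm. 17.14 (use of (ii)'). [GilbargTrudinger2001]
-/

noncomputable section

open Finset

namespace Literature.Geometry.Riemannian.GurskyViaclovsky

section Concavity

variable {A B : Fin 4 → Fin 4 → ℝ}

/-- Along the segment, `A + s(B − A) = (1 − s)A + sB` entrywise. [folklore] -/
theorem segment_entry (A B : Fin 4 → Fin 4 → ℝ) (s : ℝ) :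
    (fun a b ↦ A a b + s * (B a b - A a b)) = fun a b ↦ (1 - s) * A a b + s * B a b := by
  funext a b
  ring

/-- `σ₂` along a segment of symmetric arrays is the quadratic polynomial
`σ₂(A + s(B − A)) = (1−s)²σ₂(A) + s²σ₂(B) + 2(1−s)s σ₂(A,B)`. [folklore] -/
theorem sigma2_segment (hA : ∀ a b, A a b = A b a) (hB : ∀ a b, B a b = B b a) (s : ℝ) :
    sigma2 (fun a b ↦ A a b + s * (B a b - A a b)) =
      (1 - s) ^ 2 * sigma2 A + s ^ 2 * sigma2 B + 2 * (1 - s) * s * sigma2Polar A B := by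
  rw [segment_entry, sigma2_smul_add_smul hA hB (1 - s) s]

/-- The derivative of `s ↦ σ₂(A + s(B − A))` at `s = 0` is `2(σ₂(A,B) − σ₂(A))`. [folklore] -/
theorem hasDerivAt_sigma2_segment (hA : ∀ a b, A a b = A b a) (hB : ∀ a b, B a b = B b a) :
    HasDerivAt (fun s : ℝ ↦ sigma2 (fun a b ↦ A a b + s * (B a b - A a b)))
      (2 * (sigma2Polar A B - sigma2 A)) 0 := by
  have hfun : (fun s : ℝ ↦ sigma2 (fun a b ↦ A a b + s * (B a b - A a b))) =
      fun s ↦ sigma2 A + (2 * (sigma2Polar A B - sigma2 A) * s +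
        (sigma2 A + sigma2 B - 2 * sigma2Polar A B) * s ^ 2) := by
    funext s
    rw [sigma2_segment hA hB s]
    ring
  rw [hfun]
  have h1 : HasDerivAt (fun s : ℝ ↦ 2 * (sigma2Polar A B - sigma2 A) * s)
      (2 * (sigma2Polar A B - sigma2 A)) 0 := by
    simpa using (hasDerivAt_id (0 : ℝ)).const_mul (2 * (sigma2Polar A B - sigma2 A))
  have h2 : HasDerivAt (fun s : ℝ ↦ (sigma2 A + sigma2 B - 2 * sigma2Polar A B) * s ^ 2) 0 0 := by
    simpa using (hasDerivAt_pow 2 (0 : ℝ)).const_mul (sigma2 A + sigma2 B - 2 * sigma2Polar A B)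
  have h := (h1.add h2).const_add (sigma2 A)
  rwa [add_zero] at h

/-- The derivative of `s ↦ σ₂^{1/2}(A + s(B − A))` at `s = 0`, for `σ₂(A) > 0`, is
`(σ₂(A,B) − σ₂(A))/σ₂(A)^{1/2}` — the quantity `F_{ij}(…, D²u(y))(D_{ij}u(x) − D_{ij}u(y))` of
Gilbarg–Trudinger's proof for `F = σ₂^{1/2}`. [cite: GilbargTrudinger2001, §17.4, proof of
Thm. 17.14] -/
theorem hasDerivAt_sqrt_sigma2_segment (hA : ∀ a b, A a b = A b a) (hB : ∀ a b, B a b = B b a)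
    (hA2 : 0 < sigma2 A) :
    HasDerivAt (fun s : ℝ ↦ Real.sqrt (sigma2 (fun a b ↦ A a b + s * (B a b - A a b))))
      ((sigma2Polar A B - sigma2 A) / Real.sqrt (sigma2 A)) 0 := by
  have hd := hasDerivAt_sigma2_segment hA hB
  have h0 : sigma2 (fun a b ↦ A a b + (0 : ℝ) * (B a b - A a b)) ≠ 0 := by
    simp only [zero_mul, add_zero]
    exact hA2.ne'
  have h := hd.sqrt h0
  simp only [zero_mul, add_zero] at h
  convert h using 1
  field_simp

/-- **The supporting-hyperplane inequality for `σ₂^{1/2}` on `Γ₂⁺`** (the form in which the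
Evans–Krylov proof uses concavity): for symmetric `A, B ∈ Γ₂⁺`,
`σ₂^{1/2}(B) − σ₂^{1/2}(A) ≤ (σ₂(A,B) − σ₂(A))/σ₂(A)^{1/2}` — from Gårding's inequality.
[cite: GurskyViaclovsky2003, §2 Prop. 1 (iii)] [cite: GilbargTrudinger2001, §17.4, proof of
Thm. 17.14, use of (ii)'] -/
theorem sqrt_sigma2_le_tangent (hA : ∀ a b, A a b = A b a) (hB : ∀ a b, B a b = B b a)
    (hΓA : GammaTwoPos A) (hΓB : GammaTwoPos B) :
    Real.sqrt (sigma2 B) - Real.sqrt (sigma2 A) ≤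
      (sigma2Polar A B - sigma2 A) / Real.sqrt (sigma2 A) := by
  have hG := sqrt_mul_sqrt_le_sigma2Polar hA hB hΓA hΓB
  have hsA : 0 < Real.sqrt (sigma2 A) := Real.sqrt_pos.2 hΓA.2
  have hsq : Real.sqrt (sigma2 A) * Real.sqrt (sigma2 A) = sigma2 A := Real.mul_self_sqrt hΓA.2.le
  rw [le_div_iff₀ hsA, sub_mul, mul_comm (Real.sqrt (sigma2 B)), hsq]
  linarith

/-- **Superlevel sets of `σ₂^{1/2}` on `Γ₂⁺` are convex**: if `κ ≤ σ₂^{1/2}(A)` and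
`κ ≤ σ₂^{1/2}(B)` for symmetric `A, B ∈ Γ₂⁺`, then `κ ≤ σ₂^{1/2}((1−s)A + sB)` for `s ∈ [0,1]`.
[cite: GurskyViaclovsky2003, §2 Prop. 1 (iii)] -/
theorem le_sqrt_sigma2_convex_comb (hA : ∀ a b, A a b = A b a) (hB : ∀ a b, B a b = B b a)
    (hΓA : GammaTwoPos A) (hΓB : GammaTwoPos B) {κ s : ℝ} (hκA : κ ≤ Real.sqrt (sigma2 A))
    (hκB : κ ≤ Real.sqrt (sigma2 B)) (hs0 : 0 ≤ s) (hs1 : s ≤ 1) :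
    κ ≤ Real.sqrt (sigma2 (fun a b ↦ (1 - s) * A a b + s * B a b)) := by
  have hc := concave_sqrt_sigma2 hA hB hΓA hΓB hs0 hs1
  have h1 : (1 - s) * κ ≤ (1 - s) * Real.sqrt (sigma2 A) :=
    mul_le_mul_of_nonneg_left hκA (by linarith)
  have h2 : s * κ ≤ s * Real.sqrt (sigma2 B) := mul_le_mul_of_nonneg_left hκB hs0
  nlinarith

/-- **Admissibility with margin is preserved along segments**: for symmetric `A, B ∈ Γ₂⁺` with
`σ₂ ≥ κ² > 0`-margin, every point of the segment is in `Γ₂⁺` with the same margin.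
[cite: GurskyViaclovsky2003, §2 Prop. 1 (iii)] -/
theorem gammaTwoPos_sigma2_superlevel_convex (hA : ∀ a b, A a b = A b a)
    (hB : ∀ a b, B a b = B b a) (hΓA : GammaTwoPos A) (hΓB : GammaTwoPos B) {κ s : ℝ}
    (hκ : 0 ≤ κ) (hκA : κ ^ 2 ≤ sigma2 A) (hκB : κ ^ 2 ≤ sigma2 B) (hs0 : 0 ≤ s) (hs1 : s ≤ 1) :
    GammaTwoPos (fun a b ↦ (1 - s) * A a b + s * B a b) ∧
      κ ^ 2 ≤ sigma2 (fun a b ↦ (1 - s) * A a b + s * B a b) := by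
  refine ⟨gammaTwoPos_convex hA hB hΓA hΓB hs0 hs1, ?_⟩
  have hκA' : κ ≤ Real.sqrt (sigma2 A) := by
    rw [← Real.sqrt_sq hκ]; exact Real.sqrt_le_sqrt hκA
  have hκB' : κ ≤ Real.sqrt (sigma2 B) := by
    rw [← Real.sqrt_sq hκ]; exact Real.sqrt_le_sqrt hκB
  have h := le_sqrt_sigma2_convex_comb hA hB hΓA hΓB hκA' hκB' hs0 hs1
  have hpos : 0 ≤ sigma2 (fun a b ↦ (1 - s) * A a b + s * B a b) :=
    (gammaTwoPos_convex hA hB hΓA hΓB hs0 hs1).2.le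
  calc κ ^ 2 ≤ Real.sqrt (sigma2 (fun a b ↦ (1 - s) * A a b + s * B a b)) ^ 2 :=
        pow_le_pow_left₀ hκ h 2
    _ = sigma2 (fun a b ↦ (1 - s) * A a b + s * B a b) := Real.sq_sqrt hpos

end Concavity

end Literature.Geometry.Riemannian.GurskyViaclovsky

end
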